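import Literature.AlgebraicGeometry.Motives.ProjectiveSpaceFieldPointsBijective
import Literature.AlgebraicGeometry.Motives.BaseChangeProofs
import Mathlib.RingTheory.MvPolynomial.Tower
import HarnessLib

/-!
# Functoriality of the field-valued points `[z]` of `ℙⁿ` in the field and in the base

Two compatibilities of the `L`-points `pointOfVec k z : Spec L → ℙⁿ_k` with homogeneous
coordinates `z ∈ Lⁿ⁺¹` (`Motives/ProjectiveSpaceFieldPoints`, Hartshorne II Ex. 2.14 / Thm. 7.1):

* `ProjectiveSpace.pointOfVec_left_comp_algHom` — **extension of the coefficient field**: for a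
  `k`-algebra map of fields `φ : L → L'`, `[φ ∘ z] = (Spec L' → Spec L) ≫ [z]`; hence the two points
  have the same underlying point of `ℙⁿ_k` (`pt_pointOfVec_comp_algHom`).
* `ProjectiveSpace.pointOfVec_left_comp_projMap` — **base change of the projective space**: for
  `z ∈ Lⁿ⁺¹`, the `L`-rational point `[z]` of `ℙⁿ_L` followed by `ℙⁿ_L → ℙⁿ_k` (`Proj` of
  `k[x] → L[x]`, `ProjBaseChange.mapGraded`) is the `L`-point `[z]` of `ℙⁿ_k`.

Both are checked on the chart `D₊(x_i)`, `z_i ≠ 0`, where the points are `Spec` of the evaluation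
maps `k[x]_{(x_i)} → L` (`ProjectiveSpace.awayEval`) and `ℙⁿ_L → ℙⁿ_k` is `Spec` of
`HomogeneousLocalization.Away.map` (Mathlib `Proj.awayι_comp_map`).

## References

* R. Hartshorne, *Algebraic Geometry* (1977), II Ex. 2.14, II Thm. 7.1. [Hartshorne1977]
* Q. Liu, *Algebraic Geometry and Arithmetic Curves* (2002), Ex. 3.1.10 (`(ℙⁿ_A)_C = ℙⁿ_C`). [Liu2002]
-/

noncomputable section

open CategoryTheory AlgebraicGeometry HomogeneousLocalization MvPolynomial

universe u

namespace Literature.AlgebraicGeometry.Motives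

namespace ProjectiveSpace

attribute [local instance] MvPolynomial.gradedAlgebra ProjBaseChange.algebraBase

variable {k : Type u} [Field k] {n : ℕ}

/-! ### Extension of the coefficient field -/

section FieldExtension

variable {L L' : Type u} [Field L] [Field L'] [Algebra k L] [Algebra k L'] (φ : L →ₐ[k] L')

/-- `φ ∘ z ≠ 0` for `z ≠ 0`. [folklore] -/
theorem comp_ne_zero {z : Fin (n + 1) → L} (hz : z ≠ 0) : (φ ∘ z) ≠ 0 := by
  obtain ⟨i, hi⟩ := Function.ne_iff.mp hz
  exact Function.ne_iff.mpr ⟨i, by simpa using hi⟩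

/-- Evaluation at `φ ∘ z` is `φ` after evaluation at `z`, on the chart rings. [folklore] -/
theorem awayEval_comp {t : MvPolynomial (Fin (n + 1)) k} {d : ℕ} (ht : t ∈ homogeneousSubmodule (Fin (n + 1)) k d)
    (z : Fin (n + 1) → L) (hz : aeval z t ≠ 0) (hz' : aeval (φ ∘ z) t ≠ 0) :
    (awayEval (φ ∘ z) hz').toRingHom = φ.toRingHom.comp (awayEval z hz).toRingHom := by
  refine RingHom.ext fun q => ?_
  obtain ⟨m, g, hg, rfl⟩ := Away.mk_surjective (homogeneousSubmodule (Fin (n + 1)) k) ht q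
  simp only [AlgHom.toRingHom_eq_coe, RingHom.coe_coe, RingHom.coe_comp, Function.comp_apply]
  rw [awayEval_mk _ _ ht, awayEval_mk _ _ ht, map_div₀, map_pow, comp_aeval_apply, comp_aeval_apply]
  rfl

/-- **`[φ ∘ z] = (Spec L' → Spec L) ≫ [z]`** for a `k`-algebra map of fields `φ : L → L'`.
[cite: Hartshorne1977, II Ex. 2.14] -/
theorem pointOfVec_left_comp_algHom (z : Fin (n + 1) → L) (hz : z ≠ 0) :
    (pointOfVec k (φ ∘ z) (comp_ne_zero φ hz)).left =
      Spec.map (CommRingCat.ofHom φ.toRingHom) ≫ (pointOfVec k z hz).left := by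
  set i := firstNe z hz with hi
  have hzi : aeval z (X i : MvPolynomial (Fin (n + 1)) k) ≠ 0 := aeval_X_ne_zero (apply_firstNe_ne_zero z hz)
  have hzi' : aeval (φ ∘ z) (X i : MvPolynomial (Fin (n + 1)) k) ≠ 0 := by
    simpa using (map_ne_zero φ).mpr (apply_firstNe_ne_zero z hz)
  rw [pointOfVec_eq_chartPoint (φ ∘ z) _ (X_mem i) one_pos hzi',
    pointOfVec_eq_chartPoint z hz (X_mem i) one_pos hzi, chartPoint_left, chartPoint_left,
    awayEval_comp φ (X_mem i) z hzi hzi', CommRingCat.ofHom_comp, Spec.map_comp, Category.assoc]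
  rfl

/-- Hence the same underlying point of `ℙⁿ_k`. [folklore] -/
theorem pt_pointOfVec_comp_algHom (z : Fin (n + 1) → L) (hz : z ≠ 0) :
    (pointOfVec k (φ ∘ z) (comp_ne_zero φ hz)).pt = (pointOfVec k z hz).pt := by
  change (pointOfVec k (φ ∘ z) (comp_ne_zero φ hz)).left (IsLocalRing.closedPoint L') =
    (pointOfVec k z hz).left (IsLocalRing.closedPoint L)
  rw [pointOfVec_left_comp_algHom φ z hz]
  show (pointOfVec k z hz).left ((Spec.map (CommRingCat.ofHom φ.toRingHom)) (IsLocalRing.closedPoint L')) = _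
  congr 1
  exact Subsingleton.elim (α := PrimeSpectrum L) _ _

end FieldExtension

/-! ### Base change of the projective space -/

section BaseChange

variable {L : Type u} [Field L] [Algebra k L]

open ProjBaseChange

/-- Evaluation at `z ∈ Lⁿ⁺¹` on `L[x]_{(x_i)}` after the base-change map `k[x]_{(x_i)} → L[x]_{(x_i)}`
(`HomogeneousLocalization.Away.map` of `k[x] → L[x]`) is evaluation at `z` on `k[x]_{(x_i)}`.
[folklore] -/
theorem awayEval_comp_awayMap_mapGraded (i : Fin (n + 1)) (z : Fin (n + 1) → L)
    (hzL : aeval z (mapGraded k L (Fin (n + 1)) (X i : MvPolynomial (Fin (n + 1)) k)) ≠ 0)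
    (hzk : aeval z (X i : MvPolynomial (Fin (n + 1)) k) ≠ 0) :
    (awayEval (k := L) z hzL).toRingHom.comp
        (Away.map (mapGraded k L (Fin (n + 1))) (X i : MvPolynomial (Fin (n + 1)) k)) =
      (awayEval (k := k) z hzk).toRingHom := by
  refine RingHom.ext fun q => ?_
  obtain ⟨m, g, hg, rfl⟩ := Away.mk_surjective (homogeneousSubmodule (Fin (n + 1)) k) (X_mem i) q
  simp only [AlgHom.toRingHom_eq_coe, RingHom.coe_comp, RingHom.coe_coe, Function.comp_apply,
    Away.map_mk]
  rw [awayEval_mk _ _ ((mapGraded k L (Fin (n + 1))).map_mem (X_mem i)), awayEval_mk _ _ (X_mem i)]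
  change aeval z (MvPolynomial.map (algebraMap k L) g) /
      aeval z (MvPolynomial.map (algebraMap k L) (X i : MvPolynomial (Fin (n + 1)) k)) ^ m = _
  rw [aeval_map_algebraMap, aeval_map_algebraMap]

/-- **`[z]_L ≫ (ℙⁿ_L → ℙⁿ_k) = [z]_k`**: the `L`-rational point of `ℙⁿ_L` with coordinates
`z ∈ Lⁿ⁺¹`, followed by the base-change morphism, is the `L`-point of `ℙⁿ_k` with the same
coordinates. [cite: Liu2002, Ex. 3.1.10] [cite: Hartshorne1977, II Ex. 2.14] -/
theorem pointOfVec_left_comp_projMap (z : Fin (n + 1) → L) (hz : z ≠ 0) :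
    (pointOfVec L z hz).left ≫ Proj.map (mapGraded k L (Fin (n + 1))) (irrelevant_le_map k L (Fin (n + 1))) =
      (pointOfVec k z hz).left := by
  set i := firstNe z hz with hi
  have hzk : aeval z (X i : MvPolynomial (Fin (n + 1)) k) ≠ 0 := aeval_X_ne_zero (apply_firstNe_ne_zero z hz)
  have hzL : aeval z (mapGraded k L (Fin (n + 1)) (X i : MvPolynomial (Fin (n + 1)) k)) ≠ 0 := by
    rw [mapGraded_apply, map_X]
    exact aeval_X_ne_zero (apply_firstNe_ne_zero z hz)
  rw [pointOfVec_eq_chartPoint (k := L) z hz ((mapGraded k L (Fin (n + 1))).map_mem (X_mem i)) one_pos hzL,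
    pointOfVec_eq_chartPoint (k := k) z hz (X_mem i) one_pos hzk, chartPoint_left, chartPoint_left]
  change (Spec.map (CommRingCat.ofHom (awayEval z hzL).toRingHom) ≫
      Proj.awayι (homogeneousSubmodule (Fin (n + 1)) L) _ ((mapGraded k L (Fin (n + 1))).map_mem (X_mem i)) one_pos) ≫
    Proj.map (mapGraded k L (Fin (n + 1))) (irrelevant_le_map k L (Fin (n + 1))) = _
  rw [Category.assoc, Proj.awayι_comp_map _ _ one_pos _ (X_mem i), ← Category.assoc, ← Spec.map_comp,
    ← CommRingCat.ofHom_comp, awayEval_comp_awayMap_mapGraded i z hzL hzk]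

end BaseChange

end ProjectiveSpace

end Literature.AlgebraicGeometry.Motives

end
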